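import Summits.HodgeConjecture.HodgeConjecture.Theorems.F0P3cStCharTSJacCartanWeight                -- ★ p852323 (this seat, file 1 ∕ 2): `addEquivAddHaarChar_eq_sqrt_normAbs`
import Summits.HodgeConjecture.HodgeConjecture.Theorems.F0P3cStCharTSJacCartanElliptic              -- ★ p852303 (LH5-p02) C8b-model HEAD `tubeJacobianLocal_elliptic_model`
import Summits.HodgeConjecture.HodgeConjecture.Theorems.F0P3cStCharTSTubeJacobianTransportNonsplit  -- ★ p852024 (A-p12) Q9-CM `tubeJacobianLocal_Gqs_of_forall_model`, `localNonsplitEquiv_mem_iff`, `isRegularElt_localNonsplitEquiv_iff`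
import Summits.HodgeConjecture.HodgeConjecture.Theorems.F0P3cStCharTSHCDModel                       -- ★ p852237 (LH6-p03) model letters: `map_transpose_placeForm_qsForm`, `isUnit_det_placeForm_qsForm`; brings ★ `model_pins`, ★ (MP) `exists_units_galAdicCompletionMap_eq_neg`
import Summits.HodgeConjecture.HodgeConjecture.Theorems.F0P3cStCharTSDGLc                           -- ★ (F0P3-p02) `dgFormula_eventually_eq` (the closed form is locally constant at regular points)
import Literature.NumberTheory.Rogawski1990.TypeThreeCubicTorusNonsplit                             -- ★ `charpoly_localNonsplitEquiv`, `bijective_evalRingHom_of_nonsplit`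
import HarnessLib

/-!
# F0 · P3c · line LH6 «StCharTS» — ROAD «JAC-ELL» brick «WEIGHT-DOCK», file 2 ∕ 2 «THE DOCK»: the local tube-Jacobian socket of (E1b)∕(E4) at every COMPACT Cartan subgroup
# `T = Z(γ₀)` of `U(Φ₃)(L⁺_v)` (`v` non-split), weight `D = D_G²` in RUNG0's closed form — ★ C8b-model (LH5-p02) with `hDlc`∕`hDval` DISCHARGED, docked through ★ Q9-CM (A-p12)

Cell `pub/hodgecm-mathlib`, crux H413 = `stmt-HodgeConjecture-24833` (lane `--supports … --as helper`), route HCCMUnconditional; seat LH6-p04 (g7), organ «JAC-ELL WEIGHT-DOCK★»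
(bus F0∕P3b 2026-09-02T17:42Z; JAC-ELL author LH5-p02 (g6) «=» 17:49Z, TIE-by-import 17:53Z `F0/P3c/LH5/LH5-p02/g6/socket/TIE-E1b-JACELL-Q9CM.bypaste.LH5p02g6.lean`).  THEOREMS ONLY (no
definition ∕ instance ∕ notation ∕ named fact ∕ `sorry`); ★-only imports.

WHAT.  LH5-p02's TIE is the term `tubeJacobianLocal_Gqs_of_forall_model hT Φ hΦ hTc ν tm D w hw hT' hT'c Φ' hΦ' D' hDD' (fun ν' _ _ tm' _ _ _ _ => tubeJacobianLocal_elliptic_model _ _ hσ hσ2 hJ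
hγ₀' hT' hT'cpt hT'c ν' tm' Φ' hΦ' D' hDlc hDval)` with the REMAINING INPUTS `[CharZero L_w] [SecondCountableTopology L_w] [T2Space L_w]`, `hσ`, `hσ2`, `hJ`, `hγ₀'`, `hT'cpt`, the model
objects `T' Φ' D'` with `hT' hT'c hΦ' hDD'`, the model instances, and the two WEIGHT hypotheses `hDlc`, `hDval`.  THIS FILE discharges ALL of them from `Gqs`-side data: `T' := Z(e γ₀)`
(`= e '' T`, compact, closed), `Φ' := e ∘ Φ ∘ (e⁻¹ × e⁻¹)` on `(G′ ⧸ T') × T'` (the quotient map induced by `e⁻¹`), `D' := D ∘ e⁻¹`, Borel structures `borel`, local compactness ∕ second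
countability ∕ `T₂` transported along the homeomorphism `e`, `CharZero` ∕ second countability of `L_w` (★ `secondCountableTopology_localField`), `hσ`∕`hσ2` (★ `model_pins`), `hJ`∕hermitian
`J_w` (★ HCDModel §2), `hγ₀'` (★ `isRegularElt_localNonsplitEquiv_iff`); `hDlc` from ★ DGLc `dgFormula_eventually_eq` transported along `e⁻¹|_{T'}`; and **`hDval` from file 1 ∕ 2
★ `addEquivAddHaarChar_eq_sqrt_normAbs`** (p852323) (`χ(L) = √‖−disc ∕ det²‖_{L_w}`) read against RUNG0's closed form by §1 `weightFormula_eq_normAbs_model`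
(`∏_{w′∣v} |disc_{w′}| · (∏_{w′} |det_{w′}|)⁻² = ‖−disc(χ_{e g}) ∕ det(e g)²‖_{L_w}`: one place over `v`, ★ `PlacesOver.subsingleton_of_smul_eq`; `χ_{e g} = χ_g.map ev_w`, ★
`charpoly_localNonsplitEquiv`; `disc` commutes with `ev_w` in degree `3`, Mathlib `discr_of_degree_eq_three`).
HEAD `tubeJacobianLocal_cartan_Gqs_elliptic`: for `T = Z(γ₀) ≤ Gqs L v` COMPACT with `γ₀` regular, any Haar `ν`, any left-invariant `tm` on `T` (finite on compacts, positive on opens,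
inversion-invariant), the conjugation family `Φ`, and the weight `D t = √(∏_{w′} |disc χ_t|_{w′} · (∏_{w′} |det t|_{w′})⁻²)` (so that `(𝔇.DG t)² = D t` under RUNG0's `eDG`, ★
`WeightIdElliptic.DG_sq_eq_sqrt` — (E4)'s `hDGsq`): the (E1b)∕(E4) socket `∀ t₀ regular, ∃ U A₀, … ν(Φ(A₀ × V)) = μ₀(A₀) · ∫⁻_V D dtm` — (E4) `weylIntegrationFormula_of_pins_of_tubeJacobians`'s
`hJac i` at every compact `T i`, token for token (the split `T i = M` is ★ JAC-LOC `tubeJacobianLocal_cartan_Gqs_vanDijkWeight_sq`).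
HONEST LABEL: count-neutral plumbing; closes no organ by itself (it makes the compact-torus tube-Jacobian socket `hJacT` of junction v7 ★-reachable); HC_CM is proved only modulo the 7
printed citations (2 remaining: hLiu418 = `stmt-HodgeConjecture-24832`, h413 = `stmt-HodgeConjecture-24833`) until rung 0 closes.

## References
* [HarishChandra1970] Harish-Chandra (notes by G. van Dijk), *Harmonic analysis on reductive p-adic groups*, LNM 162 (1970), Part V §4 Lemma 22.
* [Rogawski1990] J. D. Rogawski, *Automorphic Representations of Unitary Groups in Three Variables*, Ann. of Math. Stud. 123 (1990), §12.5 p. 182 (Weyl integration formula), §4.9 p. 54 (`D_G`).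
* [PlatonovRapinchuk1994] V. Platonov, A. Rapinchuk, *Algebraic Groups and Number Theory* (1994), §5.1 (the one-place model `G_{F_v}`).
-/

set_option autoImplicit false
-- the mandated namespace has the single-problem summit's repeated segment (`HodgeConjecture.HodgeConjecture`)
set_option linter.dupNamespace false

noncomputable section

open MeasureTheory Measure Set Filter Topology Function NumberField IsDedekindDomain Polynomial
open Literature.MeasureTheory.Group
open Literature.NumberTheory.Automorphic Literature.NumberTheory.Automorphic.UnitaryGroup
open Literature.NumberTheory.GaloisRepresentations.IsNonarchimedeanLocalField (normAbs)
open Literature.NumberTheory.Rogawski1990 (IsRegularElt isRegularElt_iff Gqs qsForm)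
open Summit.HodgeConjecture.HodgeConjecture.Cruxes.H413.F0P3cStCharTSTubeJacobianTransportNonsplit
open Summit.HodgeConjecture.HodgeConjecture.Cruxes.H413.F0P3cStCharTSJacCartanElliptic
open scoped ENNReal NNReal Matrix MatrixGroups Pointwise

namespace Summit.HodgeConjecture.HodgeConjecture.Cruxes.H413.F0P3cStCharTSJacCartanWeightDock

/-! ## §1 The weight dictionary: RUNG0's closed form on `U(Φ₃)(L⁺_v)` is `‖−disc ∕ det²‖_{L_w}` on the one-place model -/

/-- `disc` commutes with a ring map in degree `3` (Mathlib's explicit cubic formula on both sides). [folklore] -/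
theorem discr_map_of_degree_eq_three {R S : Type*} [CommRing R] [CommRing S] (f : R →+* S) (p : R[X]) (hp : p.degree = 3)
    (hp' : (p.map f).degree = 3) : (p.map f).discr = f p.discr := by
  rw [Polynomial.discr_of_degree_eq_three hp, Polynomial.discr_of_degree_eq_three hp']
  simp only [Polynomial.coeff_map, map_add, map_sub, map_mul, map_pow, map_ofNat]

section CM

variable (L : Type) [Field L] [NumberField L] [IsCMField L] (v : HeightOneSpectrum (𝓞 ↥(maximalRealSubfield L)))
  (w : PlacesOver L v) (hw : IsCMField.complexConj L • w.1 = w.1)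

include hw in
/-- **THE WEIGHT DICTIONARY.**  At a non-split `v` (one place `w ∣ v`, ★ `PlacesOver.subsingleton_of_smul_eq`), for `g ∈ U(Φ₃)(L⁺_v)` with model image `e g ∈ U(σ_w, Φ₃)(L_w)`
(`e = localNonsplitEquiv`, matrix `= (matrix of g).map ev_w`): `∏_{w′} |disc(χ_g)_{w′}|_{w′} · (∏_{w′} |det(g)_{w′}|_{w′})⁻² = ‖−disc(χ_{e g}) ∕ det(e g)²‖_{L_w}` in `ℝ≥0`
(RUNG0's `eDG` radicand = the radicand of file 1 ∕ 2's `addEquivAddHaarChar_eq_sqrt_normAbs`). [cite: Rogawski1990, §4.9 p. 54] [cite: PlatonovRapinchuk1994, §5.1] -/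
theorem weightFormula_eq_normAbs_model (g : Gqs L v) :
    (∏ w' : PlacesOver L v, normAbs (w'.1.adicCompletion L) (((g.val : GL (Fin 3) (UnitaryGroup.LocalRing L v)).val.charpoly.discr) w')) *
        ((∏ w' : PlacesOver L v, normAbs (w'.1.adicCompletion L) (((g.val : GL (Fin 3) (UnitaryGroup.LocalRing L v)).val.det) w')) ^ 2)⁻¹ =
      normAbs (w.1.adicCompletion L)
        (-(((localNonsplitEquiv (IsCMField.complexConj L) (qsForm L) (IsCMField.complexConj_ne_one L) w hw g :
              ↥(unitaryGroupOfForm (galAdicCompletionMap (L := L) (IsCMField.complexConj L) hw) (placeForm (qsForm L) w.1))) :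
              GL (Fin 3) (w.1.adicCompletion L)) : Matrix (Fin 3) (Fin 3) (w.1.adicCompletion L)).charpoly.discr /
          (((localNonsplitEquiv (IsCMField.complexConj L) (qsForm L) (IsCMField.complexConj_ne_one L) w hw g :
              ↥(unitaryGroupOfForm (galAdicCompletionMap (L := L) (IsCMField.complexConj L) hw) (placeForm (qsForm L) w.1))) :
              GL (Fin 3) (w.1.adicCompletion L)) : Matrix (Fin 3) (Fin 3) (w.1.adicCompletion L)).det ^ 2) := by
  haveI : Subsingleton (PlacesOver L v) := PlacesOver.subsingleton_of_smul_eq (IsCMField.complexConj L) (IsCMField.complexConj_ne_one L) w hw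
  set ev := Pi.evalRingHom (fun w' : PlacesOver L v => w'.1.adicCompletion L) w with hev
  haveI : Nontrivial (UnitaryGroup.LocalRing L v) := ev.domain_nontrivial
  -- the model matrix is the `w`-component
  have hmat : (((localNonsplitEquiv (IsCMField.complexConj L) (qsForm L) (IsCMField.complexConj_ne_one L) w hw g :
        ↥(unitaryGroupOfForm (galAdicCompletionMap (L := L) (IsCMField.complexConj L) hw) (placeForm (qsForm L) w.1))) :
        GL (Fin 3) (w.1.adicCompletion L)) : Matrix (Fin 3) (Fin 3) (w.1.adicCompletion L)) =
      ((g.val : GL (Fin 3) (UnitaryGroup.LocalRing L v)).val : Matrix (Fin 3) (Fin 3) (UnitaryGroup.LocalRing L v)).map ev := rfl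
  have hchar := Literature.NumberTheory.Rogawski1990.charpoly_localNonsplitEquiv (L := L) (w := w) (hw := hw) (g := g)
  have hdeg : ((g.val : GL (Fin 3) (UnitaryGroup.LocalRing L v)).val : Matrix (Fin 3) (Fin 3) (UnitaryGroup.LocalRing L v)).charpoly.degree = 3 := by
    rw [Matrix.charpoly_degree_eq_dim]; rfl
  have hdeg' : (((g.val : GL (Fin 3) (UnitaryGroup.LocalRing L v)).val : Matrix (Fin 3) (Fin 3) (UnitaryGroup.LocalRing L v)).charpoly.map ev).degree = 3 := by
    rw [← Matrix.charpoly_map, Matrix.charpoly_degree_eq_dim]; rfl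
  have hdisc : (((localNonsplitEquiv (IsCMField.complexConj L) (qsForm L) (IsCMField.complexConj_ne_one L) w hw g :
        ↥(unitaryGroupOfForm (galAdicCompletionMap (L := L) (IsCMField.complexConj L) hw) (placeForm (qsForm L) w.1))) :
        GL (Fin 3) (w.1.adicCompletion L)) : Matrix (Fin 3) (Fin 3) (w.1.adicCompletion L)).charpoly.discr =
      ((g.val : GL (Fin 3) (UnitaryGroup.LocalRing L v)).val.charpoly.discr) w := by
    rw [hchar, discr_map_of_degree_eq_three ev _ hdeg hdeg', hev, Pi.evalRingHom_apply]
  have hdet : (((localNonsplitEquiv (IsCMField.complexConj L) (qsForm L) (IsCMField.complexConj_ne_one L) w hw g :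
        ↥(unitaryGroupOfForm (galAdicCompletionMap (L := L) (IsCMField.complexConj L) hw) (placeForm (qsForm L) w.1))) :
        GL (Fin 3) (w.1.adicCompletion L)) : Matrix (Fin 3) (Fin 3) (w.1.adicCompletion L)).det =
      ((g.val : GL (Fin 3) (UnitaryGroup.LocalRing L v)).val.det) w := by
    rw [hmat, ← RingHom.mapMatrix_apply, ← RingHom.map_det, hev, Pi.evalRingHom_apply]
  have hneg1 : normAbs (w.1.adicCompletion L) (-1) = 1 := by
    have h := map_mul (normAbs (w.1.adicCompletion L)) (-1) (-1)
    rw [neg_one_mul, neg_neg, map_one] at h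
    have h' : normAbs (w.1.adicCompletion L) (-1) ^ 2 = 1 := by rw [pow_two]; exact h.symm
    exact (pow_eq_one_iff.1 h').resolve_right two_ne_zero
  rw [Fintype.prod_subsingleton _ w, Fintype.prod_subsingleton _ w, hdisc, hdet, neg_div, ← neg_one_mul, map_mul, hneg1, one_mul, map_div₀, map_pow,
    div_eq_mul_inv]

/-! ## §2 THE DOCK: (E1b)∕(E4)'s local tube-Jacobian socket at a COMPACT Cartan subgroup of `U(Φ₃)(L⁺_v)`, weight `D = D_G²` in RUNG0's closed form -/

set_option maxHeartbeats 1600000 in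
-- the model instantiation elaborates the long socket binders of ★ Q9-CM and ★ C8b-model at `K = L_w`
include hw in
/-- **WEIGHT-DOCK — the local tube-Jacobian socket on `Gqs L v = U(Φ₃)(L⁺_v)` at a COMPACT Cartan subgroup `T = Z(γ₀)`** (`γ₀` regular, `v` non-split with `w ∣ v` fixed by `c̄`):
for any Haar `ν` (right-invariant class), any left-invariant `tm` on `T` (finite on compacts, positive on opens, inversion-invariant), the conjugation family `Φ`, and the weight
`D t = √(∏_{w′∣v} |disc χ_t|_{w′} · (∏_{w′} |det t|_{w′})⁻²)` (= `(𝔇.DG t)²` under RUNG0's `eDG`, ★ `WeightIdElliptic.DG_sq_eq_sqrt`), EVERY regular `t₀ ∈ T` has an open `U ∋ t₀` and a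
Borel transversal class `A₀` of positive finite quotient mass with `ν(Φ(A₀ × V)) = μ₀(A₀) · ∫⁻_V D dtm` for all Borel `W`-free regular `V ⊆ U` — (E4)'s `hJac i` at `T i = T`.  Proof:
LH5-p02's TIE term (★ Q9-CM ∘ ★ C8b-model) with every model-side input constructed ∕ discharged here (`T' = Z(e γ₀) = e '' T`, `Φ' = e ∘ Φ ∘ (e⁻¹ × e⁻¹)`, `D' = D ∘ e⁻¹`, Borel
structures, transported instances, ★ `model_pins`, ★ HCDModel §2, ★ `isRegularElt_localNonsplitEquiv_iff`), `hDlc` by ★ DGLc `dgFormula_eventually_eq`, and `hDval` by file 1 ∕ 2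
`addEquivAddHaarChar_eq_sqrt_normAbs` + §1. [cite: HarishChandra1970, Lemma 22] [cite: Rogawski1990, §12.5 p. 182; §4.9 p. 54] [cite: PlatonovRapinchuk1994, §5.1] -/
theorem tubeJacobianLocal_cartan_Gqs_elliptic
    {T : Subgroup (Gqs L v)} {γ₀ : Gqs L v}
    (hT : T = Subgroup.centralizer ({γ₀} : Set (Gqs L v)))
    (hγ₀ : IsRegularElt (γ₀.val : GL (Fin 3) (UnitaryGroup.LocalRing L v)))
    (hTcpt : IsCompact (T : Set (Gqs L v)))
    (Φ : (Gqs L v ⧸ T) × ↥T → Gqs L v) (hΦ : ∀ (x : Gqs L v) (t : ↥T), Φ (QuotientGroup.mk x, t) = x * t * x⁻¹)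
    [MeasurableSpace (Gqs L v)] [BorelSpace (Gqs L v)] [LocallyCompactSpace (Gqs L v)] [SecondCountableTopology (Gqs L v)]
    [T2Space (Gqs L v)] (hTc : IsClosed (T : Set (Gqs L v)))
    [MeasurableSpace (Gqs L v ⧸ T)] [BorelSpace (Gqs L v ⧸ T)]
    (ν : Measure (Gqs L v)) [ν.IsHaarMeasure] [ν.IsMulRightInvariant]
    (tm : Measure ↥T) [tm.IsMulLeftInvariant] [IsFiniteMeasureOnCompacts tm] [tm.IsOpenPosMeasure] [tm.IsInvInvariant]
    (D : ↥T → ℝ≥0)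
    (hD : ∀ t : ↥T, D t = NNReal.sqrt
      ((∏ w' : PlacesOver L v, normAbs (w'.1.adicCompletion L) ((((t : Gqs L v).val : GL (Fin 3) (UnitaryGroup.LocalRing L v)).val.charpoly.discr) w')) *
        ((∏ w' : PlacesOver L v, normAbs (w'.1.adicCompletion L) ((((t : Gqs L v).val : GL (Fin 3) (UnitaryGroup.LocalRing L v)).val.det) w')) ^ 2)⁻¹)) :
    ∀ t₀ : ↥T, IsRegularElt (((t₀ : Gqs L v)).val : GL (Fin 3) (UnitaryGroup.LocalRing L v)) →
      ∃ U : Set ↥T, IsOpen U ∧ t₀ ∈ U ∧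
        ∃ A₀ : Set (Gqs L v ⧸ T), MeasurableSet A₀ ∧ (quotientMeasure T tm hTc ν) A₀ ≠ 0 ∧
          (quotientMeasure T tm hTc ν) A₀ ≠ ∞ ∧
          ∀ V : Set ↥T, MeasurableSet V → V ⊆ U → (∀ t ∈ V, IsRegularElt (((t : Gqs L v)).val : GL (Fin 3) (UnitaryGroup.LocalRing L v))) →
            (∀ n : Gqs L v, n ∉ T → ∀ t ∈ V, ∀ t' ∈ V, ((t' : ↥T) : Gqs L v) ≠ n * t * n⁻¹) →
              ν (Φ '' (A₀ ×ˢ V)) = (quotientMeasure T tm hTc ν) A₀ * ∫⁻ t in V, (D t : ℝ≥0∞) ∂tm := by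
  classical
  -- ### the one-place model
  set K := w.1.adicCompletion L with hK
  set σ := galAdicCompletionMap (L := L) (IsCMField.complexConj L) hw with hσdef
  set J := placeForm (qsForm L) w.1 with hJdef
  set e := localNonsplitEquiv (IsCMField.complexConj L) (qsForm L) (IsCMField.complexConj_ne_one L) w hw with hedef
  obtain ⟨hσ2, -, hσc, -⟩ := F0P3cStCharTSTubeModelTransport.model_pins L v w hw
  have hJ : IsUnit J.det := F0P3cStCharTSHCDModel.isUnit_det_placeForm_qsForm L v w
  have hJh : (J.map σ)ᵀ = J := F0P3cStCharTSHCDModel.map_transpose_placeForm_qsForm L v w hw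
  haveI : CharZero K := charZero_of_injective_algebraMap (algebraMap L K).injective
  haveI : SecondCountableTopology K := secondCountableTopology_localField K
  have hσne : ∃ a : K, σ a ≠ a := by
    obtain ⟨lam, hlam⟩ := exists_units_galAdicCompletionMap_eq_neg (IsCMField.complexConj L) (IsCMField.complexConj_ne_one L) v w hw
    refine ⟨(lam : K), fun h => lam.ne_zero ?_⟩
    have h2 : (2 : K) * (lam : K) = 0 := by rw [two_mul]; nth_rw 1 [← h]; rw [hlam, neg_add_cancel]
    exact (mul_eq_zero.1 h2).resolve_left two_ne_zero
  -- ### the model Cartan `T' = Z(e γ₀)`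
  set γ₀' := e γ₀ with hγ₀'def
  have hγ₀' : IsRegularElt ((γ₀' : ↥(unitaryGroupOfForm σ J)) : GL (Fin 3) K) :=
    (isRegularElt_localNonsplitEquiv_iff (IsCMField.complexConj L) 3 (qsForm L) (IsCMField.complexConj_ne_one L) w hw γ₀).2 hγ₀
  set T' : Subgroup ↥(unitaryGroupOfForm σ J) := Subgroup.centralizer ({γ₀'} : Set ↥(unitaryGroupOfForm σ J)) with hT'def
  have hT' : ∀ g', g' ∈ T' ↔ g' * e γ₀ = e γ₀ * g' := fun g' => by
    rw [hT'def, Subgroup.mem_centralizer_iff]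
    exact ⟨fun h => (h γ₀' (Set.mem_singleton _)).symm, fun h x hx => by rw [Set.mem_singleton_iff.1 hx]; exact h.symm⟩
  have hTT' : ∀ g : Gqs L v, e.toMulEquiv g ∈ T' ↔ g ∈ T :=
    localNonsplitEquiv_mem_iff (IsCMField.complexConj L) 3 (qsForm L) (IsCMField.complexConj_ne_one L) w hw hT hT'
  -- `e⁻¹` read with values in the `Gqs`-typed carrier (the (E1b) side), and its algebra
  let es : ↥(unitaryGroupOfForm σ J) → Gqs L v := fun y => e.symm y
  have hes_mul : ∀ a b, es (a * b) = es a * es b := fun a b => map_mul e.symm a b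
  have hes_inv : ∀ a, es a⁻¹ = (es a)⁻¹ := fun a => map_inv e.symm a
  have he_es : ∀ y, e (es y) = y := fun y => e.apply_symm_apply y
  have hes_e : ∀ g : Gqs L v, es (e g) = g := fun g => e.symm_apply_apply g
  have hes_c : Continuous es := e.symm.continuous
  have hmemT' : ∀ g' : ↥(unitaryGroupOfForm σ J), g' ∈ T' ↔ es g' ∈ T := fun g' => by
    have h := hTT' (es g')
    have h2 : e.toMulEquiv (es g') = g' := he_es g'
    rw [h2] at h
    exact h
  have hset : (T' : Set ↥(unitaryGroupOfForm σ J)) = e '' (T : Set (Gqs L v)) := by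
    ext g'
    constructor
    · intro hg'
      exact ⟨es g', (hmemT' g').1 hg', he_es g'⟩
    · rintro ⟨g, hg, rfl⟩
      exact (hTT' g).2 hg
  have hT'cpt : IsCompact (T' : Set ↥(unitaryGroupOfForm σ J)) := by rw [hset]; exact hTcpt.image e.continuous
  -- ### transported instances on the model group and Borel structures
  haveI : T2Space ↥(unitaryGroupOfForm σ J) := e.symm.toHomeomorph.symm.t2Space
  haveI : SecondCountableTopology ↥(unitaryGroupOfForm σ J) := e.symm.toHomeomorph.secondCountableTopology
  haveI : LocallyCompactSpace ↥(unitaryGroupOfForm σ J) := e.symm.toHomeomorph.isClosedEmbedding.locallyCompactSpace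
  have hT'c : IsClosed (T' : Set ↥(unitaryGroupOfForm σ J)) := hT'cpt.isClosed
  letI : MeasurableSpace ↥(unitaryGroupOfForm σ J) := borel _
  haveI : BorelSpace ↥(unitaryGroupOfForm σ J) := ⟨rfl⟩
  letI : MeasurableSpace (↥(unitaryGroupOfForm σ J) ⧸ T') := borel _
  haveI : BorelSpace (↥(unitaryGroupOfForm σ J) ⧸ T') := ⟨rfl⟩
  -- ### the model conjugation family `Φ' = e ∘ Φ ∘ (e⁻¹ × e⁻¹)`
  let qm : ↥(unitaryGroupOfForm σ J) ⧸ T' → Gqs L v ⧸ T :=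
    Quotient.map' es fun a b hab => by
      rw [QuotientGroup.leftRel_apply] at hab ⊢
      have h : es (a⁻¹ * b) ∈ T := (hmemT' _).1 hab
      rw [hes_mul, hes_inv] at h
      exact h
  have hqm : ∀ y : ↥(unitaryGroupOfForm σ J), qm (QuotientGroup.mk y) = QuotientGroup.mk (es y) := fun y => rfl
  let Φ' : (↥(unitaryGroupOfForm σ J) ⧸ T') × ↥T' → ↥(unitaryGroupOfForm σ J) :=
    fun p => e (Φ (qm p.1, ⟨es (p.2 : ↥(unitaryGroupOfForm σ J)), (hmemT' _).1 p.2.2⟩))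
  have hΦ' : ∀ (y : ↥(unitaryGroupOfForm σ J)) (t' : ↥T'), Φ' (QuotientGroup.mk y, t') = y * t' * y⁻¹ := by
    intro y t'
    show e (Φ (qm (QuotientGroup.mk y), ⟨es (t' : ↥(unitaryGroupOfForm σ J)), (hmemT' _).1 t'.2⟩)) = y * t' * y⁻¹
    rw [hqm, hΦ]
    show e (es y * es (t' : ↥(unitaryGroupOfForm σ J)) * (es y)⁻¹) = y * t' * y⁻¹
    rw [← hes_inv, ← hes_mul, ← hes_mul, he_es]
  -- ### the model weight `D' = D ∘ e⁻¹`
  let ψ : ↥T' → ↥T := fun t' => ⟨es (t' : ↥(unitaryGroupOfForm σ J)), (hmemT' _).1 t'.2⟩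
  have hψc : Continuous ψ := (hes_c.comp continuous_subtype_val).subtype_mk _
  let D' : ↥T' → ℝ≥0 := fun t' => D (ψ t')
  have hDD' : ∀ (t : ↥T) (h : e.toMulEquiv (t : Gqs L v) ∈ T'), D' ⟨e.toMulEquiv (t : Gqs L v), h⟩ = D t := by
    intro t h
    show D (ψ ⟨e.toMulEquiv (t : Gqs L v), h⟩) = D t
    congr 1
    apply Subtype.ext
    exact hes_e (t : Gqs L v)
  -- regularity along `ψ`
  have hψreg : ∀ t' : ↥T', IsRegularElt (((t' : ↥(unitaryGroupOfForm σ J))) : GL (Fin 3) K) →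
      IsRegularElt ((((ψ t' : ↥T) : Gqs L v)).val : GL (Fin 3) (UnitaryGroup.LocalRing L v)) := by
    intro t' ht'
    have h := (isRegularElt_localNonsplitEquiv_iff (IsCMField.complexConj L) 3 (qsForm L) (IsCMField.complexConj_ne_one L) w hw
      (es (t' : ↥(unitaryGroupOfForm σ J)))).1
    refine h ?_
    have h2 : e.toMulEquiv (es (t' : ↥(unitaryGroupOfForm σ J))) = (t' : ↥(unitaryGroupOfForm σ J)) := he_es _
    rw [h2]
    exact ht'
  -- `D` is locally constant at the regular points of `T` (★ DGLc, the closed form), hence so is `D'` on `T'`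
  have hDlcT : ∀ s₀ : ↥T, IsRegularElt (((s₀ : Gqs L v)).val : GL (Fin 3) (UnitaryGroup.LocalRing L v)) → ∀ᶠ s in 𝓝 s₀, D s = D s₀ := by
    intro s₀ hs₀
    have h := (continuous_subtype_val.tendsto s₀).eventually (F0P3cStCharTSDGLc.dgFormula_eventually_eq L v (s₀ : Gqs L v) hs₀)
    filter_upwards [h] with s hs
    rw [hD s, hD s₀]
    have hs' := NNReal.coe_injective hs
    exact congrArg NNReal.sqrt (NNReal.sqrt.injective (NNReal.sqrt.injective hs'))
  have hDlc : ∀ t₀ : ↥T', IsRegularElt (((t₀ : ↥(unitaryGroupOfForm σ J))) : GL (Fin 3) K) → ∀ᶠ t in 𝓝 t₀, D' t = D' t₀ := by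
    intro t₀' ht₀'
    exact (hψc.tendsto t₀').eventually (hDlcT (ψ t₀') (hψreg t₀' ht₀'))
  -- ### `hDval`: file 1 ∕ 2 + §1
  have hDval : ∀ t₀ : ↥T', IsRegularElt ((t₀ : ↥(unitaryGroupOfForm σ J)) : GL (Fin 3) K) →
      ∀ (𝔲 : AddSubgroup (Matrix (Fin 3) (Fin 3) K)) [MeasurableSpace ↥𝔲] [BorelSpace ↥𝔲] [LocallyCompactSpace ↥𝔲],
        (∀ X, X ∈ 𝔲 ↔ (X.map σ)ᵀ * J + J * X = 0) → ∀ Lm : ↥𝔲 ≃ₜ+ ↥𝔲,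
          (∀ X : ↥𝔲, (X : Matrix (Fin 3) (Fin 3) K) * (((t₀ : ↥(unitaryGroupOfForm σ J)) : GL (Fin 3) K) : Matrix (Fin 3) (Fin 3) K) =
              (((t₀ : ↥(unitaryGroupOfForm σ J)) : GL (Fin 3) K) : Matrix (Fin 3) (Fin 3) K) * X → Lm X = X) →
          (∀ (X : ↥𝔲) (Y : Matrix (Fin 3) (Fin 3) K),
              (X : Matrix (Fin 3) (Fin 3) K) = (((t₀ : ↥(unitaryGroupOfForm σ J)) : GL (Fin 3) K) : Matrix (Fin 3) (Fin 3) K) * Y *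
                  ((((t₀ : ↥(unitaryGroupOfForm σ J)) : GL (Fin 3) K)⁻¹ : GL (Fin 3) K) : Matrix (Fin 3) (Fin 3) K) - Y →
              ((Lm X : ↥𝔲) : Matrix (Fin 3) (Fin 3) K) = ((((t₀ : ↥(unitaryGroupOfForm σ J)) : GL (Fin 3) K)⁻¹ : GL (Fin 3) K) : Matrix (Fin 3) (Fin 3) K) * X *
                  (((t₀ : ↥(unitaryGroupOfForm σ J)) : GL (Fin 3) K) : Matrix (Fin 3) (Fin 3) K) - X) →
          ((D' t₀ : ℝ≥0) : ℝ≥0∞) = addEquivAddHaarChar Lm := by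
    intro t₀' ht₀' 𝔲 _ _ _ h𝔲 Lm hLt hLm
    have hU : ((((t₀' : ↥(unitaryGroupOfForm σ J)) : GL (Fin 3) K) : Matrix (Fin 3) (Fin 3) K).map σ)ᵀ * J *
        (((t₀' : ↥(unitaryGroupOfForm σ J)) : GL (Fin 3) K) : Matrix (Fin 3) (Fin 3) K) = J :=
      mem_unitaryGroupOfForm_iff.1 (t₀' : ↥(unitaryGroupOfForm σ J)).2
    have hsep : ((((t₀' : ↥(unitaryGroupOfForm σ J)) : GL (Fin 3) K) : Matrix (Fin 3) (Fin 3) K)).charpoly.Separable := (isRegularElt_iff _).1 ht₀'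
    rw [F0P3cStCharTSJacCartanWeight.addEquivAddHaarChar_eq_sqrt_normAbs σ hσc hσ2 hσne J hJ hJh _ hU hsep 𝔲 h𝔲 Lm hLt hLm]
    congr 1
    show D (ψ t₀') = _
    have hmodel : e (((ψ t₀' : ↥T) : Gqs L v)) = (t₀' : ↥(unitaryGroupOfForm σ J)) := he_es _
    rw [hD, weightFormula_eq_normAbs_model L v w hw ((ψ t₀' : ↥T) : Gqs L v), hmodel]
  -- ### the TIE term (LH5-p02): ★ Q9-CM fed with ★ C8b-model
  exact tubeJacobianLocal_Gqs_of_forall_model hT Φ hΦ hTc ν tm D w hw hT' hT'c Φ' hΦ' D' hDD'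
    (fun ν' _ _ tm' _ _ _ _ => tubeJacobianLocal_elliptic_model _ _ hσc hσ2 hJ hγ₀' hT' hT'cpt hT'c ν' tm' Φ' hΦ' D' hDlc hDval)

end CM

end Summit.HodgeConjecture.HodgeConjecture.Cruxes.H413.F0P3cStCharTSJacCartanWeightDock

end
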